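import Mathlib

/-!
# Hadamard 668 census, family F12 — the Frobenius class `Z₃₇ ⋊ Z₉` (four cyclotomic classes) is EMPTY, in the kernel

Framing: lottery ticket; floor = certified bounds/negative ranges.

Cell pub-namedobj (venture DiscreteObjects), target (H), hadamard gen 5, family F12 (hadamard g4's FAMILY-F12.md §3b left
this class OPEN, reduced to a 2-(19,9,4) fixed subdesign plus an 18 × 18 class matrix; gen 5 closes it).

Setting (FAMILY-F12 §1–§2).  A symmetric 2-(667,333,166) design (equivalently a Hadamard matrix of order 668 normalised on
a row and a column) with the automorphism group `G = Z₃₇ ⋊ U`, `U ≤ (ℤ/37)ˣ` of order 9, all point- and block-orbits of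
length 1 or 37, minimal fixed structure: one fixed point `∞`, one fixed block `Π`, eighteen point-orbits `O_i` and
eighteen block-orbits `Ω_j` of length 37.  The ORBIT MATRIX of `Z₃₇` has entries `w i j` = number of blocks of `Ω_j`
through a point of `O_i`, `s i = [O_i ⊆ Π]`, `r j = [∞ ∈ blocks of Ω_j]`, and satisfies the classical orbit-matrix
equations (Janko–Tonchev; FAMILY-F12 §2 (d) summed over orbits):
  rows     `Σ_j w i j = 333 - s i`,   `Σ_j (w i j)² = 167 + 166·37 - 37·s i = 6309 - 37 s i`,
  pairs    `Σ_j w i j · w i' j = 166·37 - 37·s i·s i' = 6142 - 37 s i s i'`  (i ≠ i'),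
  columns  `Σ_i w i j = 333 - r j`,   `Σ_i (w i j)² = 6309 - 37 r j`.
`U`-invariance makes every incidence set `F_ij ⊆ ℤ/37` a union of `{0}` (present iff `b i j = 1`, the incidence of the two
`U`-fixed base elements) and of `z i j ∈ {0,…,4}` of the four `U`-cosets of size 9, so `w i j = b i j + 9·z i j`.

THEOREM (`no_frobenius37_index4`): this integer system has no solution.  Proof (three counting steps, no tables, no
`decide`): (A) `orbitRow37_9` — in every row `Σ z = 36`, `Σ (z-2)² = 2` (second moments; the deviation `d = z - 2` is
`+1` once, `-1` once, `0` sixteen times), and the same in every column; (B) `orbitPair37_9` — the pair equation then forces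
`Σ_j d i j · d i' j = 0` for `i ≠ i'` (`|Σ b d'| ≤ Σ d'² = 2` leaves no room for a multiple of 81); (C) the Gram identity
`Σ_j (Σ_i d i j)² = Σ_i Σ_j (d i j)² + Σ_{i ≠ i'} Σ_j d i j d i' j = 36`, while every column sum `Σ_i d i j` vanishes.
Hence no symmetric 2-(667,333,166) design — no H(668) — admits `Z₃₇ ⋊ Z₉` acting with orbit lengths {1, 37} and one fixed
point (the reduction automorphism group ⇒ orbit/type matrix is FAMILY-F12 §2, on paper, refereed by verify-ref g39).
With hadamard g4's ten classes, EVERY Frobenius class `Z_p ⋊ Z_d`, `p ∈ {23,29,37,83}`, `(p-1)/d ≤ 4`, is now decided NONE.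
Ours, not literature; no `sorry`, no `decide`, no `native_decide`.
-/

open Finset BigOperators

namespace Summit.Ventures.DiscreteObjects.Hadamard

/-! ## §A  One orbit-matrix line: the weight profile is forced -/

/-- termwise facts for `b ∈ {0,1}` and an integer `t`: `b·t ≤ t²` and `-t² ≤ b·t` -/
lemma b_mul_le_sq (b t : ℤ) (hb : b = 0 ∨ b = 1) : b * t ≤ t ^ 2 ∧ -(t ^ 2) ≤ b * t := by
  rcases hb with rfl | rfl
  · constructor <;> nlinarith [sq_nonneg t]
  · rcases le_or_gt t 0 with h | h
    · constructor <;> nlinarith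
    · have h1 : 1 ≤ t := h
      constructor <;> nlinarith

/-- **Row lemma (37,9).**  For one line of the orbit matrix — eighteen cells `w = b + 9 z` with `b ∈ {0,1}`,
`0 ≤ z ≤ 4`, a fixed-structure bit `σ ∈ {0,1}`, first moment `333 - σ` and second moment `6309 - 37 σ` — the class
counts satisfy `Σ z = 36`, `Σ (z-2)² = 2`, `Σ b = 9 - σ` and `Σ b (z-2) = -1`.  Pure linear arithmetic on the four
aggregates `Σ b, Σ z, Σ z², Σ b z` after the termwise bounds `(z-2)² ± b (z-2) ≥ 0`, `0 ≤ b z ≤ 4 b`. -/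
theorem orbitRow37_9 {ι : Type*} [Fintype ι] (hcard : Fintype.card ι = 18) (b z : ι → ℤ) (σ : ℤ)
    (hb : ∀ j, b j = 0 ∨ b j = 1) (hz : ∀ j, 0 ≤ z j ∧ z j ≤ 4) (hσ : σ = 0 ∨ σ = 1)
    (h1 : ∑ j, (b j + 9 * z j) = 333 - σ) (h2 : ∑ j, (b j + 9 * z j) ^ 2 = 6309 - 37 * σ) :
    ∑ j, z j = 36 ∧ ∑ j, (z j - 2) ^ 2 = 2 ∧ ∑ j, b j = 9 - σ ∧ ∑ j, b j * (z j - 2) = -1 := by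
  have hcardι : (Finset.univ : Finset ι).card = 18 := by rw [Finset.card_univ, hcard]
  -- first moment in aggregates
  have e1 : ∑ j, (b j + 9 * z j) = ∑ j, b j + 9 * ∑ j, z j := by
    rw [Finset.sum_add_distrib, Finset.mul_sum]
  -- second moment in aggregates (b² = b)
  have e2 : ∑ j, (b j + 9 * z j) ^ 2 = ∑ j, b j + 18 * ∑ j, b j * z j + 81 * ∑ j, z j ^ 2 := by
    have : ∀ j ∈ (Finset.univ : Finset ι), (b j + 9 * z j) ^ 2 = b j + 18 * (b j * z j) + 81 * z j ^ 2 := by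
      intro j _
      have hbb : b j * b j = b j := by rcases hb j with h | h <;> simp [h]
      have : (b j + 9 * z j) ^ 2 = b j * b j + 18 * (b j * z j) + 81 * z j ^ 2 := by ring
      rw [this, hbb]
    rw [Finset.sum_congr rfl this, Finset.sum_add_distrib, Finset.sum_add_distrib, Finset.mul_sum, Finset.mul_sum]
  -- the deviation sums in aggregates
  have e3 : ∑ j, (z j - 2) ^ 2 = ∑ j, z j ^ 2 - 4 * ∑ j, z j + 72 := by
    have : ∀ j ∈ (Finset.univ : Finset ι), (z j - 2) ^ 2 = z j ^ 2 - 4 * z j + 4 := by intro j _; ring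
    rw [Finset.sum_congr rfl this, Finset.sum_add_distrib, Finset.sum_sub_distrib, Finset.mul_sum, Finset.sum_const,
      hcardι]
    norm_num
  have e4 : ∑ j, b j * (z j - 2) = ∑ j, b j * z j - 2 * ∑ j, b j := by
    have : ∀ j ∈ (Finset.univ : Finset ι), b j * (z j - 2) = b j * z j - 2 * b j := by intro j _; ring
    rw [Finset.sum_congr rfl this, Finset.sum_sub_distrib, Finset.mul_sum]
  -- termwise bounds, summed
  have N1 : 0 ≤ ∑ j, ((z j - 2) ^ 2 - b j * (z j - 2)) :=
    Finset.sum_nonneg fun j _ => by have := (b_mul_le_sq (b j) (z j - 2) (hb j)).1; linarith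
  have N2 : 0 ≤ ∑ j, ((z j - 2) ^ 2 + b j * (z j - 2)) :=
    Finset.sum_nonneg fun j _ => by have := (b_mul_le_sq (b j) (z j - 2) (hb j)).2; linarith
  rw [Finset.sum_sub_distrib, e3, e4] at N1
  rw [Finset.sum_add_distrib, e3, e4] at N2
  have B0 : 0 ≤ ∑ j, b j := Finset.sum_nonneg fun j _ => by rcases hb j with h | h <;> simp [h]
  have B0' : ∑ j, b j ≤ 18 := by
    have : ∑ j, b j ≤ ∑ _j : ι, (1 : ℤ) := Finset.sum_le_sum fun j _ => by rcases hb j with h | h <;> simp [h]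
    simpa [Finset.sum_const, hcardι] using this
  have B1 : 0 ≤ ∑ j, b j * z j :=
    Finset.sum_nonneg fun j _ => by rcases hb j with h | h <;> simp [h, (hz j).1]
  have B2 : ∑ j, b j * z j ≤ 4 * ∑ j, b j := by
    rw [Finset.mul_sum]
    exact Finset.sum_le_sum fun j _ => by rcases hb j with h | h <;> simp [h, (hz j).2]
  rw [e1] at h1
  rw [e2] at h2
  rw [e3, e4]
  -- linear arithmetic on the aggregates
  generalize ∑ j, b j = Sb at *
  generalize ∑ j, z j = Sz at *
  generalize ∑ j, z j ^ 2 = Szz at *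
  generalize ∑ j, b j * z j = Sbz at *
  rcases hσ with rfl | rfl <;> interval_cases Sb <;> omega

/-! ## §B  Two orbit-matrix rows: the deviations are orthogonal -/

/-- **Pair lemma (37,9).**  For two point-orbit rows with the §A profile (`Σ z = 36`, `Σ (z-2)² = 2`, `Σ b = 9 - σ`),
the orbit-matrix pair equation `Σ_j (b + 9z)(b' + 9z') = 6142 - 37 σ σ'` forces `Σ_j (z-2)(z'-2) = 0`. -/
theorem orbitPair37_9 {ι : Type*} [Fintype ι] (hcard : Fintype.card ι = 18) (b z b' z' : ι → ℤ) (σ σ' : ℤ)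
    (hb : ∀ j, b j = 0 ∨ b j = 1) (hb' : ∀ j, b' j = 0 ∨ b' j = 1) (hσ : σ = 0 ∨ σ = 1) (hσ' : σ' = 0 ∨ σ' = 1)
    (hz1 : ∑ j, z j = 36) (hz2 : ∑ j, (z j - 2) ^ 2 = 2) (hbs : ∑ j, b j = 9 - σ)
    (hz1' : ∑ j, z' j = 36) (hz2' : ∑ j, (z' j - 2) ^ 2 = 2) (hbs' : ∑ j, b' j = 9 - σ')
    (hp : ∑ j, (b j + 9 * z j) * (b' j + 9 * z' j) = 6142 - 37 * σ * σ') :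
    ∑ j, (z j - 2) * (z' j - 2) = 0 := by
  have hcardι : (Finset.univ : Finset ι).card = 18 := by rw [Finset.card_univ, hcard]
  -- expand the pair equation in aggregates
  have e : ∑ j, (b j + 9 * z j) * (b' j + 9 * z' j) = ∑ j, b j * b' j
      + 9 * (2 * ∑ j, b j + ∑ j, b j * (z' j - 2) + 2 * ∑ j, b' j + ∑ j, b' j * (z j - 2))
      + 81 * (72 + 2 * (∑ j, z j - 36) + 2 * (∑ j, z' j - 36) + ∑ j, (z j - 2) * (z' j - 2)) := by
    have : ∀ j ∈ (Finset.univ : Finset ι), (b j + 9 * z j) * (b' j + 9 * z' j) = b j * b' j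
        + 9 * (2 * b j + b j * (z' j - 2) + 2 * b' j + b' j * (z j - 2))
        + 81 * (4 + 2 * (z j - 2) + 2 * (z' j - 2) + (z j - 2) * (z' j - 2)) := by intro j _; ring
    rw [Finset.sum_congr rfl this]
    simp only [Finset.sum_add_distrib, Finset.sum_sub_distrib, ← Finset.mul_sum, Finset.sum_const, hcardι,
      nsmul_eq_mul]
    push_cast
    ring
  -- bounds on the aggregates
  have P0 : 0 ≤ ∑ j, b j * b' j :=
    Finset.sum_nonneg fun j _ => by rcases hb j with h | h <;> rcases hb' j with h' | h' <;> simp [h, h']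
  have P1 : ∑ j, b j * b' j ≤ ∑ j, b j :=
    Finset.sum_le_sum fun j _ => by rcases hb j with h | h <;> rcases hb' j with h' | h' <;> simp [h, h']
  have X1 : ∑ j, b j * (z' j - 2) ≤ ∑ j, (z' j - 2) ^ 2 :=
    Finset.sum_le_sum fun j _ => (b_mul_le_sq (b j) (z' j - 2) (hb j)).1
  have X2 : -(∑ j, (z' j - 2) ^ 2) ≤ ∑ j, b j * (z' j - 2) := by
    rw [← Finset.sum_neg_distrib]; exact Finset.sum_le_sum fun j _ => (b_mul_le_sq (b j) (z' j - 2) (hb j)).2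
  have Y1 : ∑ j, b' j * (z j - 2) ≤ ∑ j, (z j - 2) ^ 2 :=
    Finset.sum_le_sum fun j _ => (b_mul_le_sq (b' j) (z j - 2) (hb' j)).1
  have Y2 : -(∑ j, (z j - 2) ^ 2) ≤ ∑ j, b' j * (z j - 2) := by
    rw [← Finset.sum_neg_distrib]; exact Finset.sum_le_sum fun j _ => (b_mul_le_sq (b' j) (z j - 2) (hb' j)).2
  rw [e, hz1, hz1', hbs, hbs'] at hp
  rw [hz2'] at X1 X2
  rw [hz2] at Y1 Y2
  rw [hbs] at P1
  generalize ∑ j, b j * b' j = P at *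
  generalize ∑ j, b j * (z' j - 2) = X at *
  generalize ∑ j, b' j * (z j - 2) = Y at *
  generalize ∑ j, (z j - 2) * (z' j - 2) = γ at *
  rcases hσ with rfl | rfl <;> rcases hσ' with rfl | rfl <;> omega

/-! ## §C  The orbit matrix does not exist -/

/-- **Family F12, class `Z₃₇ ⋊ Z₉` — NONE (kernel theorem, orbit-matrix level).**  There are no `18 × 18` integer
matrices `b` (entries in {0,1}), `z` (entries in {0,…,4}) and vectors `s, r ∈ {0,1}^18` such that `w = b + 9 z`
satisfies the orbit-matrix equations of `Z₃₇` on a symmetric 2-(667,333,166) design with one fixed point: row sums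
`333 - s i`, row second moments `6309 - 37 s i`, row-pair products `6142 - 37 s i s i'`, column sums `333 - r j`, column
second moments `6309 - 37 r j`.  Consequently no symmetric 2-(667,333,166) design, and no Hadamard matrix of order 668,
admits the Frobenius group `Z₃₇ ⋊ Z₉` (order 333) as an automorphism group with orbit lengths {1, 37} and one fixed
point (FAMILY-F12 §2 for the reduction).  The column-pair equations are not even needed. -/
theorem no_frobenius37_index4 (b z : Fin 18 → Fin 18 → ℤ) (s r : Fin 18 → ℤ)
    (hb : ∀ i j, b i j = 0 ∨ b i j = 1) (hz : ∀ i j, 0 ≤ z i j ∧ z i j ≤ 4)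
    (hs : ∀ i, s i = 0 ∨ s i = 1) (hr : ∀ j, r j = 0 ∨ r j = 1)
    (hR1 : ∀ i, ∑ j, (b i j + 9 * z i j) = 333 - s i)
    (hR2 : ∀ i, ∑ j, (b i j + 9 * z i j) ^ 2 = 6309 - 37 * s i)
    (hP : ∀ i i', i ≠ i' → ∑ j, (b i j + 9 * z i j) * (b i' j + 9 * z i' j) = 6142 - 37 * s i * s i')
    (hC1 : ∀ j, ∑ i, (b i j + 9 * z i j) = 333 - r j)
    (hC2 : ∀ j, ∑ i, (b i j + 9 * z i j) ^ 2 = 6309 - 37 * r j) : False := by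
  have h18 : Fintype.card (Fin 18) = 18 := Fintype.card_fin 18
  -- §A for rows and for columns
  have rowA := fun i => orbitRow37_9 h18 (b i) (z i) (s i) (hb i) (hz i) (hs i) (hR1 i) (hR2 i)
  have colA := fun j => orbitRow37_9 h18 (fun i => b i j) (fun i => z i j) (r j) (fun i => hb i j) (fun i => hz i j)
    (hr j) (hC1 j) (hC2 j)
  -- §B for every pair of distinct rows; together with §A: the deviation Gram matrix is `2·1`
  have diag : ∀ i, ∑ j, (z i j - 2) * (z i j - 2) = 2 := fun i =>
    calc ∑ j, (z i j - 2) * (z i j - 2) = ∑ j, (z i j - 2) ^ 2 := Finset.sum_congr rfl fun j _ => by ring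
      _ = 2 := (rowA i).2.1
  have gram : ∀ i i', ∑ j, (z i j - 2) * (z i' j - 2) = if i = i' then 2 else 0 := by
    intro i i'
    split_ifs with h
    · rw [← h]
      exact diag i
    · exact orbitPair37_9 h18 (b i) (z i) (b i') (z i') (s i) (s i') (hb i) (hb i') (hs i) (hs i') (rowA i).1
        (rowA i).2.1 (rowA i).2.2.1 (rowA i').1 (rowA i').2.1 (rowA i').2.2.1 (hP i i' h)
  -- column sums of the deviations vanish
  have colzero : ∀ j, ∑ i, (z i j - 2) = 0 := by
    intro j
    rw [Finset.sum_sub_distrib, (colA j).1]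
    simp
  -- the double sum two ways
  have T1 : ∑ i, ∑ i', ∑ j, (z i j - 2) * (z i' j - 2) = 36 := by
    simp_rw [gram]
    simp [Finset.sum_ite_eq]
  have T2 : ∑ i, ∑ i', ∑ j, (z i j - 2) * (z i' j - 2) = 0 := by
    calc ∑ i, ∑ i', ∑ j, (z i j - 2) * (z i' j - 2)
        = ∑ i, ∑ j, ∑ i', (z i j - 2) * (z i' j - 2) := Finset.sum_congr rfl fun i _ => Finset.sum_comm
      _ = ∑ j, ∑ i, ∑ i', (z i j - 2) * (z i' j - 2) := Finset.sum_comm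
      _ = ∑ j, (∑ i, (z i j - 2)) * (∑ i', (z i' j - 2)) :=
          Finset.sum_congr rfl fun j _ => by rw [Finset.sum_mul_sum]
      _ = 0 := by simp [colzero]
  omega

end Summit.Ventures.DiscreteObjects.Hadamard
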